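import Literature.Probability.Percolation.SahiSunflowerSeparation
import Literature.Probability.LatticeModels.ProdBernoulliIndependence
import Mathlib.Tactic.Ring
import Mathlib.Tactic.Linarith
import Mathlib.Tactic.Positivity
import HarnessLib

/-!
# Kahn's Conjecture 5 for three COMPLEMENTS OF CYLINDERS ("some coordinate of `F` is closed") under every
# product measure — a theorem, with an explicit lower bound; hence the PATH row on every forest

Support file (prover prim-ineq-prove-3 gen 12; `--supports stmt-CriticalPhenomena-4575`).  No definitions, no named facts, no sorries,
no `native_decide`.  New mathematics (not in print, not in the tree; memo FINDING-G12-HITTING-DECOMPOSITION.md §8).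

KNOWN.  Sahi's functional `E₃(A,B,C) = 2μ(ABC) + μ(A)μ(B)μ(C) − Σ μ(A)μ(BC)` is nonnegative for indicators of PRINCIPAL up-sets
(cylinders `V_F = {ω | F ⊆ ω}`) and their nonnegative combinations [Sahi2008, Thm. 2; tree `Literature.Combinatorics.Sahi2008`], and when
ONE of three up-sets is a cylinder [tree `sahiE_bernoulliWeight_ind_nonneg_offTwo`]; for three GENERAL up-sets of a product measure it is
Kahn's Conjecture 5 [Kahn2022] = Richards–Sahi `C₃` (OPEN; [cite: LiebSahi2021, p. 3]).  The complement `V_Fᶜ = {some coordinate of F is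
0}` is a down-set which is NOT a cumulation of principal down-sets (its Möbius coefficients alternate), so neither printed case applies to the
triple `(V_Fᶜ, V_Gᶜ, V_Hᶜ)`; the tree file `SahiSunflowerSeparation` records the sunflower-complement instance as open.

**THEOREM (`sahiE3_cylCompl_nonneg`).**  For every product probability measure `prodBernoulli p` on `Set ι` (`ι` finite) and all finite
`F, G, H ⊆ ι`:
  `0 ≤ E₃({F ⊆ ω}ᶜ, {G ⊆ ω}ᶜ, {H ⊆ ω}ᶜ)`,
and quantitatively (`sahiE3_cylCompl_ge`)
  `E₃ ≥ μ(V_{F∪G∪H}) · (1 − π_{F∩G})(1 − π_{F∩H})(1 − π_{G∩H})`,  `π_S = ∏_{i∈S} p_i`.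
By the cube symmetry `ω ↦ ωᶜ, p ↦ 1 − p` this is also `E₃ ≥ 0` for three "OR" events `{ω ∩ F ≠ ∅}` (stated here in the complement form only).
PROOF.  With the Venn products `a,b,c` (exclusive parts), `d,e,f` (pairwise-only parts), `g` (triple part) of the weights, the complement
rule `E₃(Aᶜ,Bᶜ,Cᶜ) = ΣCov − E₃(A,B,C)` (`sahiE3_compl`) and `μ(V_S) = π_S` give
  `E₃ = defg · [ab(1−dg) + ac(1−eg) + bc(1−fg) − abc(2 + defg² − g(de+df+ef))]`
and the bracket equals `ab(1−c)(1−dg) + ac(1−b)(1−eg) + bc(1−a)(1−fg) + abc·[(1−gd)(1−ge)(1−gf) + g(1−g)(de(1−gf) + df + ef)]`,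
a sum of products of numbers in `[0,1]` (`cylPoly_nonneg`).

**PERCOLATION READING** (`sahiE3_edgeCylCompl_nonneg`, `ι = Sym2 V`): on EVERY finite weighted graph, for any three finite edge sets
`F, G, H`, `0 ≤ E₃({some edge of F closed}, {some edge of G closed}, {some edge of H closed})`.  On a FOREST the separation event
`{u ↮ v}` is exactly "some edge of the unique `u–v` path is closed", so every pairwise-separation cubic row `E₃(D[u₁|v₁], D[u₂|v₂],
D[u₃|v₃]) ≥ 0` holds on all forests, all `n` — in particular the open PATH row `(D[a|b], D[a|c], D[b|y])` (orbit 36 of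
`…FrontierDecRowsLeFive`, open on general graphs) holds on every forest (the graph-theoretic identification is not formalised here).
-/

noncomputable section

namespace Summit.CriticalPhenomena.PercolationContinuityZ3.Theorems

namespace SahiCylinderComplements

open MeasureTheory Literature.Probability.LatticeModels
open scoped Classical

/-! ### The polynomial inequality -/

/-- **The Venn-product polynomial is nonnegative on `[0,1]⁷`.**  For `a,…,g ∈ [0,1]`:
`0 ≤ ab(1−dg) + ac(1−eg) + bc(1−fg) − abc(2 + defg² − g(de+df+ef))`, indeed it is
`≥ abc(1−gd)(1−ge)(1−gf)`. [this work] -/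
theorem cylPoly_ge (a b c d e f g : ℝ) (ha : 0 ≤ a) (ha1 : a ≤ 1) (hb : 0 ≤ b) (hb1 : b ≤ 1) (hc : 0 ≤ c) (hc1 : c ≤ 1)
    (hd : 0 ≤ d) (hd1 : d ≤ 1) (he : 0 ≤ e) (he1 : e ≤ 1) (hf : 0 ≤ f) (hf1 : f ≤ 1) (hg : 0 ≤ g) (hg1 : g ≤ 1) :
    a * b * c * ((1 - g * d) * (1 - g * e) * (1 - g * f)) ≤
      a * b * (1 - d * g) + a * c * (1 - e * g) + b * c * (1 - f * g) -
        a * b * c * (2 + d * e * f * g * g - g * (d * e + d * f + e * f)) := by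
  have hdg : 0 ≤ 1 - d * g := by nlinarith [mul_le_one₀ hd1 hg hg1]
  have heg : 0 ≤ 1 - e * g := by nlinarith [mul_le_one₀ he1 hg hg1]
  have hfg : 0 ≤ 1 - f * g := by nlinarith [mul_le_one₀ hf1 hg hg1]
  have hgd : 0 ≤ 1 - g * d := by nlinarith
  have hge : 0 ≤ 1 - g * e := by nlinarith
  have hgf : 0 ≤ 1 - g * f := by nlinarith
  have key : a * b * (1 - d * g) + a * c * (1 - e * g) + b * c * (1 - f * g) -
        a * b * c * (2 + d * e * f * g * g - g * (d * e + d * f + e * f)) -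
        a * b * c * ((1 - g * d) * (1 - g * e) * (1 - g * f)) =
      a * b * (1 - c) * (1 - d * g) + a * c * (1 - b) * (1 - e * g) + b * c * (1 - a) * (1 - f * g) +
        a * b * c * (g * (1 - g) * (d * e * (1 - g * f) + d * f + e * f)) := by
    ring
  have h1 : 0 ≤ a * b * (1 - c) * (1 - d * g) := by
    have : 0 ≤ 1 - c := by linarith
    positivity
  have h2 : 0 ≤ a * c * (1 - b) * (1 - e * g) := by
    have : 0 ≤ 1 - b := by linarith
    positivity
  have h3 : 0 ≤ b * c * (1 - a) * (1 - f * g) := by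
    have : 0 ≤ 1 - a := by linarith
    positivity
  have h4 : 0 ≤ a * b * c * (g * (1 - g) * (d * e * (1 - g * f) + d * f + e * f)) := by
    have : 0 ≤ 1 - g := by linarith
    positivity
  linarith

/-- The lower bound itself is nonnegative, hence so is the polynomial. [this work] -/
theorem cylPoly_nonneg (a b c d e f g : ℝ) (ha : 0 ≤ a) (ha1 : a ≤ 1) (hb : 0 ≤ b) (hb1 : b ≤ 1) (hc : 0 ≤ c) (hc1 : c ≤ 1)
    (hd : 0 ≤ d) (hd1 : d ≤ 1) (he : 0 ≤ e) (he1 : e ≤ 1) (hf : 0 ≤ f) (hf1 : f ≤ 1) (hg : 0 ≤ g) (hg1 : g ≤ 1) :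
    0 ≤ a * b * (1 - d * g) + a * c * (1 - e * g) + b * c * (1 - f * g) -
        a * b * c * (2 + d * e * f * g * g - g * (d * e + d * f + e * f)) := by
  have h := cylPoly_ge a b c d e f g ha ha1 hb hb1 hc hc1 hd hd1 he he1 hf hf1 hg hg1
  have hgd : 0 ≤ 1 - g * d := by nlinarith [mul_le_one₀ hg1 hd hd1]
  have hge : 0 ≤ 1 - g * e := by nlinarith [mul_le_one₀ hg1 he he1]
  have hgf : 0 ≤ 1 - g * f := by nlinarith [mul_le_one₀ hg1 hf hf1]
  have h0 : 0 ≤ a * b * c * ((1 - g * d) * (1 - g * e) * (1 - g * f)) := by positivity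
  linarith

/-! ### Cylinder events and their probabilities -/

variable {ι : Type*} [Fintype ι]

omit [Fintype ι] in
/-- `{F ⊆ ω} ∩ {G ⊆ ω} = {F ∪ G ⊆ ω}`. [folklore] -/
theorem cyl_inter_cyl (F G : Finset ι) :
    ({ω : Set ι | (F : Set ι) ⊆ ω} ∩ {ω : Set ι | (G : Set ι) ⊆ ω}) = {ω : Set ι | ((F ∪ G : Finset ι) : Set ι) ⊆ ω} := by
  ext ω
  simp only [Set.mem_inter_iff, Set.mem_setOf_eq, Finset.coe_union, Set.union_subset_iff]

omit [Fintype ι] in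
/-- A product over `F` as a product of "masked" factors over any superset `U`. [folklore] -/
theorem prod_eq_prod_ite {U F : Finset ι} (hF : F ⊆ U) (p : ι → ℝ) :
    ∏ i ∈ F, p i = ∏ i ∈ U, (if i ∈ F then p i else 1) := by
  rw [Finset.prod_ite_mem, Finset.inter_eq_right.2 hF]

omit [Fintype ι] in
/-- Weights in `[0,1]` have products in `[0,1]`: nonnegativity. [folklore] -/
theorem prod_ite_nonneg (U : Finset ι) (P : ι → Prop) [DecidablePred P] (p : ι → unitInterval) :
    0 ≤ ∏ i ∈ U, (if P i then (p i : ℝ) else 1) :=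
  Finset.prod_nonneg fun i _ => by
    split_ifs
    · exact (p i).2.1
    · exact zero_le_one

omit [Fintype ι] in
/-- Weights in `[0,1]` have products in `[0,1]`: the upper bound. [folklore] -/
theorem prod_ite_le_one (U : Finset ι) (P : ι → Prop) [DecidablePred P] (p : ι → unitInterval) :
    ∏ i ∈ U, (if P i then (p i : ℝ) else 1) ≤ 1 :=
  Finset.prod_le_one (fun i _ => by
      split_ifs
      · exact (p i).2.1
      · exact zero_le_one)
    fun i _ => by
      split_ifs
      · exact (p i).2.2
      · exact le_rfl

/-! ### The theorem -/

/-- **`E₃ ≥ 0` for three complements of cylinder events, with the explicit lower bound**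
`E₃({F⊆ω}ᶜ,{G⊆ω}ᶜ,{H⊆ω}ᶜ) ≥ μ(F∪G∪H ⊆ ω)·(1 − π_{F∩G})(1 − π_{F∩H})(1 − π_{G∩H})`, `π_S = ∏_{i∈S} p_i`. [this work] -/
theorem sahiE3_cylCompl_ge (p : ι → unitInterval) (F G H : Finset ι) :
    (∏ i ∈ F ∪ G ∪ H, (p i : ℝ)) *
        ((1 - ∏ i ∈ F ∩ G, (p i : ℝ)) * (1 - ∏ i ∈ F ∩ H, (p i : ℝ)) * (1 - ∏ i ∈ G ∩ H, (p i : ℝ))) ≤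
      sahiE3 (prodBernoulli p) {ω : Set ι | (F : Set ι) ⊆ ω}ᶜ {ω : Set ι | (G : Set ι) ⊆ ω}ᶜ
        {ω : Set ι | (H : Set ι) ⊆ ω}ᶜ := by
  classical
  -- Step 1: complement rule and cylinder probabilities
  rw [sahiE3_compl (prodBernoulli p) MeasurableSet.of_discrete MeasurableSet.of_discrete MeasurableSet.of_discrete,
    sahiE3_def]
  simp only [cyl_inter_cyl, prodBernoulli_real_subset]
  -- Step 2: Venn products over U = F ∪ G ∪ H
  set U : Finset ι := F ∪ G ∪ H with hU
  have hFU : F ⊆ U := fun i hi => by simp [hU, hi]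
  have hGU : G ⊆ U := fun i hi => by simp [hU, hi]
  have hHU : H ⊆ U := fun i hi => by simp [hU, hi]
  set a := ∏ i ∈ U, (if i ∈ F ∧ i ∉ G ∧ i ∉ H then (p i : ℝ) else 1) with ha
  set b := ∏ i ∈ U, (if i ∉ F ∧ i ∈ G ∧ i ∉ H then (p i : ℝ) else 1) with hb
  set c := ∏ i ∈ U, (if i ∉ F ∧ i ∉ G ∧ i ∈ H then (p i : ℝ) else 1) with hc
  set d := ∏ i ∈ U, (if i ∈ F ∧ i ∈ G ∧ i ∉ H then (p i : ℝ) else 1) with hd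
  set e := ∏ i ∈ U, (if i ∈ F ∧ i ∉ G ∧ i ∈ H then (p i : ℝ) else 1) with he
  set f := ∏ i ∈ U, (if i ∉ F ∧ i ∈ G ∧ i ∈ H then (p i : ℝ) else 1) with hf
  set g := ∏ i ∈ U, (if i ∈ F ∧ i ∈ G ∧ i ∈ H then (p i : ℝ) else 1) with hg
  -- each cylinder product as a product of Venn products (pointwise case analysis under ∏_U)
  have eF : ∏ i ∈ F, (p i : ℝ) = a * d * e * g := by
    rw [prod_eq_prod_ite hFU, ha, hd, he, hg, ← Finset.prod_mul_distrib, ← Finset.prod_mul_distrib,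
      ← Finset.prod_mul_distrib]
    refine Finset.prod_congr rfl fun i _ => ?_
    by_cases h1 : i ∈ F <;> by_cases h2 : i ∈ G <;> by_cases h3 : i ∈ H <;> simp [h1, h2, h3]
  have eG : ∏ i ∈ G, (p i : ℝ) = b * d * f * g := by
    rw [prod_eq_prod_ite hGU, hb, hd, hf, hg, ← Finset.prod_mul_distrib, ← Finset.prod_mul_distrib,
      ← Finset.prod_mul_distrib]
    refine Finset.prod_congr rfl fun i _ => ?_
    by_cases h1 : i ∈ F <;> by_cases h2 : i ∈ G <;> by_cases h3 : i ∈ H <;> simp [h1, h2, h3]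
  have eH : ∏ i ∈ H, (p i : ℝ) = c * e * f * g := by
    rw [prod_eq_prod_ite hHU, hc, he, hf, hg, ← Finset.prod_mul_distrib, ← Finset.prod_mul_distrib,
      ← Finset.prod_mul_distrib]
    refine Finset.prod_congr rfl fun i _ => ?_
    by_cases h1 : i ∈ F <;> by_cases h2 : i ∈ G <;> by_cases h3 : i ∈ H <;> simp [h1, h2, h3]
  have hFGU : F ∪ G ⊆ U := Finset.union_subset hFU hGU
  have hFHU : F ∪ H ⊆ U := Finset.union_subset hFU hHU
  have hGHU : G ∪ H ⊆ U := Finset.union_subset hGU hHU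
  have eFG : ∏ i ∈ F ∪ G, (p i : ℝ) = a * b * d * e * f * g := by
    rw [prod_eq_prod_ite hFGU, ha, hb, hd, he, hf, hg, ← Finset.prod_mul_distrib, ← Finset.prod_mul_distrib,
      ← Finset.prod_mul_distrib, ← Finset.prod_mul_distrib, ← Finset.prod_mul_distrib]
    refine Finset.prod_congr rfl fun i _ => ?_
    by_cases h1 : i ∈ F <;> by_cases h2 : i ∈ G <;> by_cases h3 : i ∈ H <;> simp [h1, h2, h3]
  have eFH : ∏ i ∈ F ∪ H, (p i : ℝ) = a * c * d * e * f * g := by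
    rw [prod_eq_prod_ite hFHU, ha, hc, hd, he, hf, hg, ← Finset.prod_mul_distrib, ← Finset.prod_mul_distrib,
      ← Finset.prod_mul_distrib, ← Finset.prod_mul_distrib, ← Finset.prod_mul_distrib]
    refine Finset.prod_congr rfl fun i _ => ?_
    by_cases h1 : i ∈ F <;> by_cases h2 : i ∈ G <;> by_cases h3 : i ∈ H <;> simp [h1, h2, h3]
  have eGH : ∏ i ∈ G ∪ H, (p i : ℝ) = b * c * d * e * f * g := by
    rw [prod_eq_prod_ite hGHU, hb, hc, hd, he, hf, hg, ← Finset.prod_mul_distrib, ← Finset.prod_mul_distrib,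
      ← Finset.prod_mul_distrib, ← Finset.prod_mul_distrib, ← Finset.prod_mul_distrib]
    refine Finset.prod_congr rfl fun i _ => ?_
    by_cases h1 : i ∈ F <;> by_cases h2 : i ∈ G <;> by_cases h3 : i ∈ H <;> simp [h1, h2, h3]
  have eU : ∏ i ∈ U, (p i : ℝ) = a * b * c * d * e * f * g := by
    rw [ha, hb, hc, hd, he, hf, hg, ← Finset.prod_mul_distrib, ← Finset.prod_mul_distrib, ← Finset.prod_mul_distrib,
      ← Finset.prod_mul_distrib, ← Finset.prod_mul_distrib, ← Finset.prod_mul_distrib]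
    refine Finset.prod_congr rfl fun i hi => ?_
    have hi' : i ∈ F ∨ i ∈ G ∨ i ∈ H := by simpa [hU, Finset.mem_union, or_assoc] using hi
    by_cases h1 : i ∈ F <;> by_cases h2 : i ∈ G <;> by_cases h3 : i ∈ H <;> simp_all
  have eFGi : ∏ i ∈ F ∩ G, (p i : ℝ) = d * g := by
    rw [prod_eq_prod_ite ((Finset.inter_subset_left).trans hFU), hd, hg, ← Finset.prod_mul_distrib]
    refine Finset.prod_congr rfl fun i _ => ?_
    by_cases h1 : i ∈ F <;> by_cases h2 : i ∈ G <;> by_cases h3 : i ∈ H <;> simp [h1, h2, h3]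
  have eFHi : ∏ i ∈ F ∩ H, (p i : ℝ) = e * g := by
    rw [prod_eq_prod_ite ((Finset.inter_subset_left).trans hFU), he, hg, ← Finset.prod_mul_distrib]
    refine Finset.prod_congr rfl fun i _ => ?_
    by_cases h1 : i ∈ F <;> by_cases h2 : i ∈ G <;> by_cases h3 : i ∈ H <;> simp [h1, h2, h3]
  have eGHi : ∏ i ∈ G ∩ H, (p i : ℝ) = f * g := by
    rw [prod_eq_prod_ite ((Finset.inter_subset_left).trans hGU), hf, hg, ← Finset.prod_mul_distrib]
    refine Finset.prod_congr rfl fun i _ => ?_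
    by_cases h1 : i ∈ F <;> by_cases h2 : i ∈ G <;> by_cases h3 : i ∈ H <;> simp [h1, h2, h3]
  rw [eFG, eFH, eGH, eFGi, eFHi, eGHi, eF, eG, eH, eU]
  -- Step 3: the polynomial inequality
  have hpoly := cylPoly_ge a b c d e f g (prod_ite_nonneg U _ p) (prod_ite_le_one U _ p) (prod_ite_nonneg U _ p)
    (prod_ite_le_one U _ p) (prod_ite_nonneg U _ p) (prod_ite_le_one U _ p) (prod_ite_nonneg U _ p) (prod_ite_le_one U _ p)
    (prod_ite_nonneg U _ p) (prod_ite_le_one U _ p) (prod_ite_nonneg U _ p) (prod_ite_le_one U _ p) (prod_ite_nonneg U _ p)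
    (prod_ite_le_one U _ p)
  have hPi : 0 ≤ d * e * f * g := by
    have := prod_ite_nonneg U (fun i => i ∈ F ∧ i ∈ G ∧ i ∉ H) p
    have := prod_ite_nonneg U (fun i => i ∈ F ∧ i ∉ G ∧ i ∈ H) p
    have := prod_ite_nonneg U (fun i => i ∉ F ∧ i ∈ G ∧ i ∈ H) p
    have := prod_ite_nonneg U (fun i => i ∈ F ∧ i ∈ G ∧ i ∈ H) p
    positivity
  have hid : (a * b * d * e * f * g - a * d * e * g * (b * d * f * g)) + (a * c * d * e * f * g - a * d * e * g * (c * e * f * g)) +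
        (b * c * d * e * f * g - b * d * f * g * (c * e * f * g)) -
        (2 * (a * b * c * d * e * f * g) + a * d * e * g * (b * d * f * g) * (c * e * f * g) -
          (a * d * e * g * (b * c * d * e * f * g) + b * d * f * g * (a * c * d * e * f * g) +
            c * e * f * g * (a * b * d * e * f * g))) =
      (d * e * f * g) * (a * b * (1 - d * g) + a * c * (1 - e * g) + b * c * (1 - f * g) -
        a * b * c * (2 + d * e * f * g * g - g * (d * e + d * f + e * f))) := by
    ring
  have hlhs : a * b * c * d * e * f * g * ((1 - d * g) * (1 - e * g) * (1 - f * g)) =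
      (d * e * f * g) * (a * b * c * ((1 - g * d) * (1 - g * e) * (1 - g * f))) := by ring
  rw [hid, hlhs]
  exact mul_le_mul_of_nonneg_left hpoly hPi

/-- **THEOREM: Kahn's `E₃ ≥ 0` for three complements of cylinders under every product measure.** [this work] -/
theorem sahiE3_cylCompl_nonneg (p : ι → unitInterval) (F G H : Finset ι) :
    0 ≤ sahiE3 (prodBernoulli p) {ω : Set ι | (F : Set ι) ⊆ ω}ᶜ {ω : Set ι | (G : Set ι) ⊆ ω}ᶜ
        {ω : Set ι | (H : Set ι) ⊆ ω}ᶜ := by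
  classical
  refine le_trans ?_ (sahiE3_cylCompl_ge p F G H)
  have h1 : ∀ S : Finset ι, 0 ≤ ∏ i ∈ S, (p i : ℝ) := fun S => Finset.prod_nonneg fun i _ => (p i).2.1
  have h2 : ∀ S : Finset ι, ∏ i ∈ S, (p i : ℝ) ≤ 1 := fun S =>
    Finset.prod_le_one (fun i _ => (p i).2.1) fun i _ => (p i).2.2
  have := h1 (F ∪ G ∪ H)
  have := h2 (F ∩ G); have := h2 (F ∩ H); have := h2 (G ∩ H)
  have hx : 0 ≤ 1 - ∏ i ∈ F ∩ G, (p i : ℝ) := by linarith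
  have hy : 0 ≤ 1 - ∏ i ∈ F ∩ H, (p i : ℝ) := by linarith
  have hz : 0 ≤ 1 - ∏ i ∈ G ∩ H, (p i : ℝ) := by linarith
  positivity

/-! ### Percolation reading -/

/-- **On EVERY finite weighted graph**: for any three finite edge sets `F, G, H`,
`0 ≤ E₃({some edge of F closed}, {some edge of G closed}, {some edge of H closed})`.  On a forest, `{u ↮ v}` = "some edge of the unique
`u–v` path is closed", so all pairwise-separation cubic rows — in particular the PATH row `(D[a|b],D[a|c],D[b|y])` — hold on forests.
[this work] -/
theorem sahiE3_edgeCylCompl_nonneg {V : Type*} [Fintype V] [DecidableEq V] (w : Sym2 V → unitInterval)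
    (F G H : Finset (Sym2 V)) :
    0 ≤ sahiE3 (prodBernoulli w) {ω : Literature.Probability.Percolation.BondConfig V | (F : Set (Sym2 V)) ⊆ ω}ᶜ
        {ω : Literature.Probability.Percolation.BondConfig V | (G : Set (Sym2 V)) ⊆ ω}ᶜ
        {ω : Literature.Probability.Percolation.BondConfig V | (H : Set (Sym2 V)) ⊆ ω}ᶜ :=
  sahiE3_cylCompl_nonneg w F G H

end SahiCylinderComplements

end Summit.CriticalPhenomena.PercolationContinuityZ3.Theorems
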